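import Mathlib
import Summits.ValiantsHypothesis.ValiantsHypothesis.Theorems.KPlusLogSqLawWeakLiftingTowerGraftSharpCount

/-!
# Crux `WeakLifting` (stmt-ValiantsHypothesis-19561), LINE (B) `tower_graft`, letter T1 —
# ISOLATED NEAR-AXIS EVENTS COST ONE EACH (Mark II of `…TowerGraftIsolatedEvents`)

Helper file for LINE (B) (`Cruxes/WeakLifting/Lines/tower_graft.lean`, letters side, memo
`Cruxes/WeakLifting/Lines/tower_graft-S5.md`, T1 «log-slope localisation»).  Objects: `A, E ∈ ℝ[X]` non-zero, the
corner graft `h = A + X^D·E`, `n = deg A + deg E`, `ρ = n/D`, the sector slope `0 < s ≤ 1` (a complex root `z` is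
OFF-SECTOR when `s‖z‖ ≤ |Im z| ∨ Re z ≤ 0`, IN-SECTOR otherwise), `Z₊` = number of distinct positive roots.

`…TowerGraftIsolatedEvents.card_posRoots_add_X_pow_mul_le_of_isolated` charged TWO crossings to every isolated in-sector root
of `A·E` and `2·Z₊(E) + 1` on top; with the Mark II interface (`…TowerGraftSharpCount.card_posRoots_add_X_pow_mul_le_of_discs_sharp`,
multiplicity count inside each disc, common roots kept apart) the same disc system — one disc of radius `(9/2)ρ‖z‖` about each
in-sector root — gives

* `card_posRoots_add_X_pow_mul_le_of_isolated_sharp` — `5n ≤ s·D`, every in-sector root `z` of `A·E` isolated from every other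
  root `z'` by `‖z − z'‖ ≥ (9/2)ρ‖z‖ + 4ρ‖z'‖`  ⟹
  `Z₊(A + X^D·E) ≤ #{in-sector roots of A·E, WITH MULTIPLICITY} + Z₊(E) + #{t > 0 : A(t) = 0 ∧ E(t) = 0} + 1`.
  For generic letters (simple roots, `A ⊥ E`): ONE crossing per isolated near-axis event plus `Z₊(E) + 1` — against the
  instance-additive shape `Z₊(A) + Z₊(E) + O(1)`, which is refuted in the tree (`…TowerGraftCornerPhantoms.not_instanceAdditive_cornerLaw`,
  lift-p2 g19): the surplus is exactly the NON-REAL in-sector roots, each paying one.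

Proof: the disc system satisfies clearance (isolation + triangle inequality) and coverage (the `4ρ‖z‖`-neighbourhood of an
in-sector root lies in its own disc), so `…_of_discs_sharp` applies; by isolation the roots of `A·E` in the disc about `z` are
exactly the copies of `z`, so the disc term is `Σ_{z} mult(z) = #{in-sector roots, with multiplicity}`
(`Multiset.toFinset_sum_count_eq`).  Mathlib + the line's earlier helper files only; axioms `propext`, `Classical.choice`,
`Quot.sound`; no `sorry`; no definitions, no named facts.

Honest framing: a `--supports` helper for a registered LINE of the V2 crux (instrument / structure tier); nothing on
`stub_graftLawCorner`, `stub_oneLetterGraftLaw`, `WeakLifting`, Conjecture B (`KPlusLogSqLaw`) or `LacunarySymmetroid`;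
`VP ≠ VNP` is NOT proved and nothing here is progress on it.
-/

-- `Summit.ValiantsHypothesis.ValiantsHypothesis.…` repeats a component by the D-0017 layout
-- (single-conjunct summit), which the `dupNamespace` linter flags; the name is mandated.
set_option linter.dupNamespace false

namespace Summit.ValiantsHypothesis.ValiantsHypothesis.Theorems.KPlusLogSqLaw.TowerGraft

open Polynomial Complex
open scoped BigOperators Polynomial Real

section IsolatedSharp

/-- **ISOLATED NEAR-AXIS EVENTS COST ONE EACH.**  See the module docstring. [this work] -/
theorem card_posRoots_add_X_pow_mul_le_of_isolated_sharp {s : ℝ} (hs : 0 < s) (hs1 : s ≤ 1) (A E : ℝ[X]) {D : ℕ} (hD : 0 < D)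
    (hA : A ≠ 0) (hE : E ≠ 0) (hdeg : 5 * ((A.natDegree : ℝ) + E.natDegree) ≤ s * D)
    (hiso : ∀ z ∈ (A.map Complex.ofRealHom).roots + (E.map Complex.ofRealHom).roots,
      ¬ (s * ‖z‖ ≤ |z.im| ∨ z.re ≤ 0) →
      ∀ z' ∈ (A.map Complex.ofRealHom).roots + (E.map Complex.ofRealHom).roots, z' ≠ z →
        (9 / 2) * (((A.natDegree : ℝ) + E.natDegree) / D) * ‖z‖ +
          4 * (((A.natDegree : ℝ) + E.natDegree) / D) * ‖z'‖ ≤ ‖z - z'‖) :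
    ((A + X ^ D * E).roots.toFinset.filter (fun t => 0 < t)).card ≤
      Multiset.card (((A.map Complex.ofRealHom).roots + (E.map Complex.ofRealHom).roots).filter
          fun z => ¬ (s * ‖z‖ ≤ |z.im| ∨ z.re ≤ 0)) +
        (E.roots.toFinset.filter (fun t => 0 < t)).card +
        (A.roots.toFinset.filter (fun t => 0 < t ∧ E.IsRoot t)).card + 1 := by
  classical
  set n : ℝ := (A.natDegree : ℝ) + E.natDegree with hn
  set ρ : ℝ := n / D with hρ
  set Z := (A.map Complex.ofRealHom).roots + (E.map Complex.ofRealHom).roots with hZ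
  set I : Finset ℂ := (Z.filter fun z => ¬ (s * ‖z‖ ≤ |z.im| ∨ z.re ≤ 0)).toFinset with hI
  have hD0 : (0 : ℝ) < D := by exact_mod_cast hD
  have hρ0 : 0 ≤ ρ := by positivity
  have hρ5 : ρ ≤ 1 / 5 := by
    rw [hρ, div_le_iff₀ hD0]; nlinarith
  have hdeg4 : 4 * ((A.natDegree : ℝ) + E.natDegree) ≤ s * D := by
    have : 0 ≤ (A.natDegree : ℝ) + E.natDegree := by positivity
    linarith
  have hAc0 : A.map Complex.ofRealHom ≠ 0 := (Polynomial.map_ne_zero_iff Complex.ofRealHom.injective).mpr hA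
  have hEc0 : E.map Complex.ofRealHom ≠ 0 := (Polynomial.map_ne_zero_iff Complex.ofRealHom.injective).mpr hE
  have hZF : ((A * E).map Complex.ofRealHom).roots = Z := by
    rw [Polynomial.map_mul, Polynomial.roots_mul (mul_ne_zero hAc0 hEc0), hZ]
  -- members of `I`
  have hImem : ∀ z ∈ I, z ∈ Z ∧ ¬ (s * ‖z‖ ≤ |z.im| ∨ z.re ≤ 0) := by
    intro z hz
    rw [hI, Multiset.mem_toFinset, Multiset.mem_filter] at hz
    exact hz
  have hIne0 : ∀ z ∈ I, z ≠ 0 := by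
    intro z hz h0
    have h := (hImem z hz).2
    rw [h0] at h
    exact h (Or.inr (by simp))
  -- `ρ > 0` as soon as a root exists
  have hcardZ : (Multiset.card Z : ℝ) = n := by
    rw [hZ, Multiset.card_add, Nat.cast_add,
      ← (IsAlgClosed.splits (A.map Complex.ofRealHom)).natDegree_eq_card_roots,
      ← (IsAlgClosed.splits (E.map Complex.ofRealHom)).natDegree_eq_card_roots,
      Polynomial.natDegree_map_eq_of_injective Complex.ofRealHom.injective,
      Polynomial.natDegree_map_eq_of_injective Complex.ofRealHom.injective, hn]
  have hρpos : ∀ z ∈ Z, 0 < ρ := by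
    intro z hz
    have hc : (0 : ℝ) < Multiset.card Z := by exact_mod_cast Multiset.card_pos_iff_exists_mem.mpr ⟨z, hz⟩
    rw [hcardZ] at hc
    exact div_pos hc hD0
  -- the disc system: one disc of radius `(9/2)ρ‖z‖` around each in-sector root (Mark II interface)
  have hmain := card_posRoots_add_X_pow_mul_le_of_discs_sharp hs hs1 A E hD hA hE hdeg4 I (fun z => z)
    (fun z => (9 / 2) * ρ * ‖z‖) ?hrad ?h0 ?hclear ?hcover
  case hrad =>
    intro z hz
    exact mul_pos (mul_pos (by norm_num) (hρpos z (hImem z hz).1)) (norm_pos_iff.mpr (hIne0 z hz))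
  case h0 =>
    intro z hz τ hτ hτ0
    rw [Metric.mem_sphere, dist_eq_norm, hτ0, zero_sub, norm_neg] at hτ
    have hzpos : 0 < ‖z‖ := norm_pos_iff.mpr (hIne0 z hz)
    nlinarith
  case hclear =>
    intro z hz τ hτ z' hz'
    rw [Metric.mem_sphere, dist_eq_norm] at hτ
    by_cases hzz : z' = z
    · subst hzz
      rw [hτ]
      nlinarith [norm_nonneg z', hρpos z' hz']
    · have hsep := hiso z (hImem z hz).1 (hImem z hz).2 z' hz' hzz
      have htri : ‖z - z'‖ ≤ ‖τ - z‖ + ‖τ - z'‖ := by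
        have := norm_sub_le_norm_sub_add_norm_sub z τ z'
        rwa [norm_sub_rev z τ] at this
      show 4 * ρ * ‖z'‖ ≤ ‖τ - z'‖
      linarith
  case hcover =>
    intro z hz hzin t ht hclose
    refine ⟨z, ?_, ?_⟩
    · rw [hI, Multiset.mem_toFinset, Multiset.mem_filter]; exact ⟨hz, hzin⟩
    · show dist (t : ℂ) z < (9 / 2) * ρ * ‖z‖
      rw [dist_eq_norm]
      have hclose' : ‖(t : ℂ) - z‖ ≤ 4 * ρ * ‖z‖ := hclose
      have hzne : z ≠ 0 := fun h0 => hzin (Or.inr (by rw [h0]; simp))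
      have : 0 < ρ * ‖z‖ := mul_pos (hρpos z hz) (norm_pos_iff.mpr hzne)
      linarith
  -- each disc contains exactly the copies of its own root among the roots of `A·E`
  have hdisc : ∀ z ∈ I,
      Multiset.card ((((A * E).map Complex.ofRealHom).roots.filter fun w => dist w z < (9 / 2) * ρ * ‖z‖)) = Z.count z := by
    intro z hz
    rw [hZF, Multiset.count_eq_card_filter_eq]
    congr 1
    refine Multiset.filter_congr fun w hw => ⟨fun hd => ?_, fun hwz => ?_⟩
    · by_contra hwz
      have hsep := hiso z (hImem z hz).1 (hImem z hz).2 w hw (fun h => hwz h.symm)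
      rw [norm_sub_rev, ← dist_eq_norm] at hsep
      have : 0 ≤ 4 * ρ * ‖w‖ := by positivity
      linarith
    · rw [← hwz, dist_self]
      exact mul_pos (mul_pos (by norm_num) (hρpos z (hImem z hz).1)) (norm_pos_iff.mpr (hIne0 z hz))
  have hsum : ∑ z ∈ I, Multiset.card ((((A * E).map Complex.ofRealHom).roots.filter
      fun w => dist w z < (9 / 2) * ρ * ‖z‖)) =
      Multiset.card (Z.filter fun z => ¬ (s * ‖z‖ ≤ |z.im| ∨ z.re ≤ 0)) := by
    rw [Finset.sum_congr rfl hdisc, hI, ← Multiset.toFinset_sum_count_eq]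
    refine Finset.sum_congr rfl fun z hz => ?_
    rw [Multiset.mem_toFinset, Multiset.mem_filter] at hz
    exact (Multiset.count_filter_of_pos (p := fun w : ℂ => ¬ (s * ‖w‖ ≤ |w.im| ∨ w.re ≤ 0)) hz.2).symm
  rw [hsum] at hmain
  exact hmain

end IsolatedSharp

end Summit.ValiantsHypothesis.ValiantsHypothesis.Theorems.KPlusLogSqLaw.TowerGraft
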